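import Summits.BirchSwinnertonDyer.BirchSwinnertonDyer.Theorems.CumulativeHeegnerLeopoldtCumulativeHeegnerInclusionAtThreeStubResidualSelmerFiniteDevissageCurve
import Literature.NumberTheory.EllipticCurves.IsogenyQuotientCurveProofs
import Literature.NumberTheory.EllipticCurves.IsogenyDualProofs
import Literature.NumberTheory.EllipticCurves.IsogenySelmerGroups
import HarnessLib

/-!
# Route `CumulativeHeegnerLeopoldt`, crux K1 `CumulativeHeegnerInclusionAtThree` (stmt-BirchSwinnertonDyer-24198),
# line `birth` v3, STUB B1: the dévissage DATUM `0 → E[g] → E[p] → E′[f] → 0` from an isogeny pair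
# `g : E → E′`, `f : E′ → E` with `f ∘ g = [p]` — i.e. from a `Γ_K`-stable subgroup `Φ ⊂ E[p]` of order `p`
# via the tree's isogeny quotient (Vélu) — and B1's per-frame conclusion from the two ISOGENY-KERNEL
# residual Selmer groups

Sixth brick for stub B1. The per-frame closer of the previous brick
(`…DevissageCurve.finite_selmerAc_empty_pTorsion_of_devissage`) needs a `Γ_K`-equivariant exact sequence
`0 → A → E[p] → C → 0` of discrete `Γ_K`-modules. For a `Γ_K`-stable subgroup `Φ ⊂ E[p]` of order `p` (on the
Leopoldt cell: the rational line `𝔽₃(φ)`) the tree's isogeny quotient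
(`WeierstrassCurve.exists_isogeny_ker_eq_and_comp_eq_nsmul_holds`: an isogeny `g : E → E′` with kernel `Φ` and an
isogeny `f : E′ → E` with `f ∘ g = [p]`, `g ∘ f = [p]`) supplies it with NO new definition:
`A = E[g] = Φ` (the `Γ_K`-module `Isogeny.kerAction`), `C = E′[f]` (`≅ E[p]/Φ`, i.e. `𝔽_p(ψ)` on the cell),
`j` the inclusion `E[g] ≤ E[p]` and `q = g|_{E[p]} : E[p] → E′[f]` (onto, because isogenies are onto on
`K̄`-points, `Isogeny.surjective`; kernel `E[g]`).

* §1 `ker_le_geomTorsion`, `apply_mem_ker_of_mem_geomTorsion` — `E[g] ⊆ E[p]` and `g(E[p]) ⊆ E′[f]` when `f ∘ g = [p]`;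
  `exists_isogenyPair_of_stable` — the isogeny pair attached to a `Γ_K`-stable `Φ ≤ E[p]` with `#Φ = p`.
* §2 **`finite_selmerAc_empty_pTorsion_of_isogenyDevissage`** — `K` imaginary quadratic, `κ` any `ℤ_p`-extension,
  `𝔭 ∋ p`, `(g, f)` an isogeny pair with `f ∘ g = [p]`: IF `E′[f]` has no non-zero point fixed by `ker κ ⊓ D_𝔭`
  (non-anomalous `ψ`) and the residual Selmer groups `R_𝔭^{Σ_bad}(K_∞, E[g])`, `R_𝔭^{Σ_bad}(K_∞, E′[f])`
  (`GreenbergVatsal2000.datumStrictSelmer` for the `Γ_K`-modules `Isogeny.kerAction`) are finite, THEN Castella's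
  `Sel_𝔭(K_∞, E[p^∞])[p]` is finite — B1's conclusion at the frame. The two finiteness inputs are statements about
  the CHARACTER modules `E[g] ≅ 𝔽_p(φ)`, `E′[f] ≅ 𝔽_p(ψ)`: CGLS 2022 Thm. 11 (Rubin's main conjecture + μ = 0,
  Oukhaba–Viguié 2016 at `p = 3`), not in the tree — the ONLY remaining content of B1 besides the ℚ̄ ↔ K̄ transport
  of the cell's line `Φ` and of its non-anomalous clause.

THEOREMS ONLY (`--supports stmt-BirchSwinnertonDyer-24198`); no definition, no named fact, no `sorry`; route-independent
imports. Seat bsd-line-chl-k1-p1-w2 (width, stub B1). BSD is not proved by any of this.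

References: [CastellaGrossiLeeSkinner2022] Prop. 17–18, Thm. 11 (arXiv:2008.02571 §1); [SilvermanAEC2009] III.4.12
(quotient by a finite subgroup), II.2.3; [GreenbergVatsal2000] §2.
-/

set_option autoImplicit false
set_option linter.dupNamespace false

noncomputable section

open scoped Classical

namespace Summit.BirchSwinnertonDyer.BirchSwinnertonDyer.Theorems.CumulativeHeegnerInclusionAtThreeStubB1IsogenyDevissage

open Literature.NumberTheory.EllipticCurves Literature.NumberTheory.EllipticCurves.GreenbergSelmer
  Literature.NumberTheory.EllipticCurves.GreenbergVatsal2000 Literature.NumberTheory.GaloisRepresentations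
  NumberField IsDedekindDomain Field WeierstrassCurve
  Summit.BirchSwinnertonDyer.Rank1Residual.X11b Summit.BirchSwinnertonDyer.Rank1Residual.X11b.AcSelmer
  Summit.BirchSwinnertonDyer.BirchSwinnertonDyer.Theorems.CumulativeHeegnerInclusionAtThreeStubB1DevissageCurve

variable {K : Type} [Field K] [NumberField K] {W W' : WeierstrassCurve K} [W.IsElliptic] [W'.IsElliptic]
  {p : ℕ}

/-! ### §1 The isogeny pair of a stable subgroup of `E[p]` -/

omit [NumberField K] [W.IsElliptic] [W'.IsElliptic] in
/-- If `f ∘ g = [p]` then `E[g] ⊆ E[p]`. [cite: SilvermanAEC2009, III.4.12 and III.6.1] -/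
theorem ker_le_geomTorsion (g : Isogeny W W') (f : Isogeny W' W) (hfg : ∀ P, f (g P) = p • P) :
    g.toAddMonoidHom.ker ≤ W.geomTorsion (p : ℤ) := by
  intro P hP
  rw [AddMonoidHom.mem_ker, Isogeny.coe_toAddMonoidHom] at hP
  exact AddSubgroup.torsionBy.nsmul_iff.mpr (by rw [← hfg, hP, map_zero])

omit [NumberField K] [W.IsElliptic] [W'.IsElliptic] in
/-- If `f ∘ g = [p]` then `g(E[p]) ⊆ E′[f]`. [cite: SilvermanAEC2009, III.4.12 and III.6.1] -/
theorem apply_mem_ker_of_mem_geomTorsion (g : Isogeny W W') (f : Isogeny W' W) (hfg : ∀ P, f (g P) = p • P)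
    (P : W.geomTorsion (p : ℤ)) : g (P : W.geomPoints) ∈ f.toAddMonoidHom.ker := by
  rw [AddMonoidHom.mem_ker, Isogeny.coe_toAddMonoidHom, hfg]
  exact AddSubgroup.torsionBy.nsmul_iff.mp P.2

/-- **The isogeny pair of a `Γ_K`-stable subgroup `Φ ⊂ E[p]` of order `p`** (the tree's isogeny quotient,
`exists_isogeny_ker_eq_and_comp_eq_nsmul_holds`, Vélu / Silverman III.4.12): isogenies `g : E → E′`, `f : E′ → E`
over `K` with `ker g = Φ`, `f ∘ g = [p]` and `g ∘ f = [p]`. [cite: SilvermanAEC2009, III.4.12] -/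
theorem exists_isogenyPair_of_stable (hp : p.Prime) (Φ : AddSubgroup (W.geomTorsion (p : ℤ)))
    (hcard : Nat.card Φ = p)
    (hstab : ∀ (σ : absoluteGaloisGroup K) (P : W.geomTorsion (p : ℤ)), P ∈ Φ → σ • P ∈ Φ) :
    ∃ (W' : WeierstrassCurve K) (_ : W'.IsElliptic) (g : Isogeny W W') (f : Isogeny W' W),
      g.toAddMonoidHom.ker = Φ.map (W.geomTorsion (p : ℤ)).subtype ∧
        (∀ P, f (g P) = p • P) ∧ ∀ Q, g (f Q) = p • Q := by
  have hcardS : Nat.card (Φ.map (W.geomTorsion (p : ℤ)).subtype) = p :=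
    (Nat.card_congr (Φ.equivMapOfInjective _
      (W.geomTorsion (p : ℤ)).subtype_injective).symm.toEquiv).trans hcard
  have hfin : ((Φ.map (W.geomTorsion (p : ℤ)).subtype : AddSubgroup W.geomPoints) :
      Set W.geomPoints).Finite := by
    have : Finite (Φ.map (W.geomTorsion (p : ℤ)).subtype) :=
      Nat.finite_of_card_ne_zero (by rw [hcardS]; exact hp.ne_zero)
    exact Set.toFinite _
  have hstabS : ∀ (σ : absoluteGaloisGroup K) (P : W.geomPoints),
      P ∈ Φ.map (W.geomTorsion (p : ℤ)).subtype → σ • P ∈ Φ.map (W.geomTorsion (p : ℤ)).subtype := by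
    rintro σ _ ⟨P, hP, rfl⟩
    refine ⟨σ • P, hstab σ P hP, ?_⟩
    show ((σ • P : W.geomTorsion (p : ℤ)) : W.geomPoints) = σ • (P : W.geomPoints)
    rw [AddSubgroup.torsionBy.coe_smul]
  obtain ⟨W', hW', g, f, hker, hfg, hgf⟩ :=
    W.exists_isogeny_ker_eq_and_comp_eq_nsmul_holds _ hfin hstabS
  exact ⟨W', hW', g, f, hker, fun P ↦ by rw [hfg, hcardS], fun Q ↦ by rw [hgf, hcardS]⟩

/-! ### §2 B1's per-frame conclusion from the residual Selmer groups of the two isogeny kernels -/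

/-- **B1's conclusion from an isogeny pair `(g, f)`, `f ∘ g = [p]`** (`K` imaginary quadratic, `κ` any
`ℤ_p`-extension, `𝔭 ∋ p`, `Σ_bad` = bad places of `E/K` prime to `p`): if `E′[f]` has no non-zero point fixed by
`ker κ ⊓ D_𝔭` and the residual Selmer groups `R_𝔭^{Σ_bad}(K_∞, E[g])`, `R_𝔭^{Σ_bad}(K_∞, E′[f])` of the two isogeny
kernels (`Γ_K`-modules `Isogeny.kerAction`) are finite, then `Sel_𝔭(K_∞, E[p^∞])[p]` is finite. Proof: the
dévissage datum `E[g] ↪ E[p] —g→ E′[f]` (exact; onto by `Isogeny.surjective`) fed to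
`finite_selmerAc_empty_pTorsion_of_devissage`. [cite: CastellaGrossiLeeSkinner2022, Prop. 17–18 (arXiv:2008.02571 §1.4)] [cite: SilvermanAEC2009, III.4.12 and II.2.3] -/
theorem finite_selmerAc_empty_pTorsion_of_isogenyDevissage [Fact p.Prime] (hK : IsImaginaryQuadratic K)
    (κ : ZpExtension K p) {𝔭 : HeightOneSpectrum (𝓞 K)} (h𝔭 : ((p : ℕ) : 𝓞 K) ∈ 𝔭.asIdeal)
    (g : Isogeny W W') (f : Isogeny W' W) (hfg : ∀ P, f (g P) = p • P)
    (hfix : ∀ Q : W'.geomPoints, Q ∈ f.toAddMonoidHom.ker →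
      (∀ σ ∈ κ.kerSubgroup ⊓ decomp 𝔭, σ • Q = Q) → Q = 0)
    (hA : letI := g.kerAction
      (datumStrictSelmer κ.kerSubgroup g.toAddMonoidHom.ker p (AcSelmer.bdpData _ p 𝔭)
        {v : HeightOneSpectrum (𝓞 K) | ¬ W.HasGoodReductionAt v ∧ ((p : ℕ) : 𝓞 K) ∉ v.asIdeal} :
        Set (subgroupH1 κ.kerSubgroup g.toAddMonoidHom.ker)).Finite)
    (hC : letI := f.kerAction
      (datumStrictSelmer κ.kerSubgroup f.toAddMonoidHom.ker p (AcSelmer.bdpData _ p 𝔭)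
        {v : HeightOneSpectrum (𝓞 K) | ¬ W.HasGoodReductionAt v ∧ ((p : ℕ) : 𝓞 K) ∉ v.asIdeal} :
        Set (subgroupH1 κ.kerSubgroup f.toAddMonoidHom.ker)).Finite) :
    Set.Finite {s : selmerAc W p κ 𝔭 ∅ | p • s = 0} := by
  letI := g.kerAction
  letI := f.kerAction
  -- `j : E[g] ↪ E[p]`
  have hle : g.toAddMonoidHom.ker ≤ W.geomTorsion (p : ℤ) := ker_le_geomTorsion g f hfg
  let j : g.toAddMonoidHom.ker →+ W.geomTorsion (p : ℤ) := AddSubgroup.inclusion hle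
  have hj' : ∀ (σ : absoluteGaloisGroup K) (a : g.toAddMonoidHom.ker), j (σ • a) = σ • j a :=
    fun σ a ↦ Subtype.ext (by
      rw [AddSubgroup.torsionBy.coe_smul]; rfl)
  have hinj : Function.Injective j := AddSubgroup.inclusion_injective hle
  -- `q = g|_{E[p]} : E[p] → E′[f]`
  let q : W.geomTorsion (p : ℤ) →+ f.toAddMonoidHom.ker :=
    (g.toAddMonoidHom.comp (W.geomTorsion (p : ℤ)).subtype).codRestrict f.toAddMonoidHom.ker
      (fun P ↦ apply_mem_ker_of_mem_geomTorsion g f hfg P)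
  have hq_coe : ∀ P : W.geomTorsion (p : ℤ), ((q P : f.toAddMonoidHom.ker) : W'.geomPoints) =
      g (P : W.geomPoints) := fun _ ↦ rfl
  have hq' : ∀ (σ : absoluteGaloisGroup K) (b : W.geomTorsion (p : ℤ)), q (σ • b) = σ • q b :=
    fun σ b ↦ Subtype.ext (by
      rw [Isogeny.kerAction_coe_smul, hq_coe, hq_coe, AddSubgroup.torsionBy.coe_smul, Isogeny.map_smul])
  have hqj : ∀ a : g.toAddMonoidHom.ker, q (j a) = 0 := fun a ↦ Subtype.ext (by
    rw [hq_coe, ZeroMemClass.coe_zero]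
    have := a.2
    rw [AddMonoidHom.mem_ker, Isogeny.coe_toAddMonoidHom] at this
    exact this)
  have hsurj : Function.Surjective q := by
    intro Q
    obtain ⟨P₀, hP₀⟩ := g.surjective (Q : W'.geomPoints)
    have hQ : f (Q : W'.geomPoints) = 0 := by
      have := Q.2
      rwa [AddMonoidHom.mem_ker, Isogeny.coe_toAddMonoidHom] at this
    have hP₀tor : P₀ ∈ W.geomTorsion (p : ℤ) :=
      AddSubgroup.torsionBy.nsmul_iff.mpr (by rw [← hfg, hP₀, hQ])
    exact ⟨⟨P₀, hP₀tor⟩, Subtype.ext (by rw [hq_coe]; exact hP₀)⟩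
  have hexact : ∀ b : W.geomTorsion (p : ℤ), q b = 0 → ∃ a : g.toAddMonoidHom.ker, j a = b := by
    intro b hb
    have hb' : g (b : W.geomPoints) = 0 := by
      have := congrArg (fun z : f.toAddMonoidHom.ker ↦ (z : W'.geomPoints)) hb
      simpa only [hq_coe, ZeroMemClass.coe_zero] using this
    refine ⟨⟨(b : W.geomPoints), ?_⟩, Subtype.ext rfl⟩
    rw [AddMonoidHom.mem_ker, Isogeny.coe_toAddMonoidHom]
    exact hb'
  have hfix' : ∀ c : f.toAddMonoidHom.ker, (∀ x : ↥(κ.kerSubgroup ⊓ decomp 𝔭), x • c = c) → c = 0 := by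
    intro c hc
    apply Subtype.ext
    rw [ZeroMemClass.coe_zero]
    refine hfix c c.2 fun σ hσ ↦ ?_
    have h : σ • c = c := hc ⟨σ, hσ⟩
    have h2 := congrArg (fun z : f.toAddMonoidHom.ker ↦ (z : W'.geomPoints)) h
    simpa only [Isogeny.kerAction_coe_smul] using h2
  exact finite_selmerAc_empty_pTorsion_of_devissage W p hK κ h𝔭 j hj' hinj q hq' hqj hsurj hexact hfix' hA hC

end Summit.BirchSwinnertonDyer.BirchSwinnertonDyer.Theorems.CumulativeHeegnerInclusionAtThreeStubB1IsogenyDevissage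

end
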